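import Literature.MathematicalPhysics.QuantumFieldTheory.Balaban1983to89.T3ContinuumYM3Torus
import HarnessLib

/-!
# Route `UnitScaleTilt`, crux K1 child «MinimiserStabilityRegPr» (stmt-QuantumFields-19200), leaf V2′ `stub_halvingStep` — PILLAR F4, PART 5
# (OWNER RULING g20-№8 §A3 «critical-point equation (158) = (143)»): **[Balaban1985Variational] (127) ⟹ (133)/(143) — THE DERIVATION OF THE
# CRITICAL-POINT EQUATION `A₀ = −G̃((δ/δA′)V)(A₀ + H₀B)` FROM CRITICALITY ON THE LINEAR CONSTRAINT `QA′ = B`, AS EXACT FINITE-DIMENSIONAL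
# LINEAR ALGEBRA** over real matrices on any finite index types (the fine bonds `PBond (F.P K) 0 × 𝔤-components` and the coarse bonds):
# `G = Δ_a⁻¹`, `K = QGQᵀ`, `H₀ = GQᵀK⁻¹` ((129)), `P₀ = 1 − GQᵀK⁻¹Q` ((131)), `G̃ = GP₀ᵀ = G − GQᵀK⁻¹QG` ((133)/(143)), with `QH₀ = 1`,
# `QG̃ = 0`, and: `⟨δA′, Δ_aA′ + w⟩ = 0 ∀ δA′ ∈ ker Q` ⟹ `A′ − H₀QA′ = −G̃w`

Cell `ym3-torus` (HUMAN RULING D-0037, YM ladder rung R3), seat `ym-ust-19200-f4` gen 0.  `--supports stmt-QuantumFields-19200 --as helper`;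
count-neutral; fifth file of pillar F4 (parts 1–4: `…FlatSmallSolution158`, `…FlatChart47`, `…FlatSmallSolution158Real`, `…FlatScalarExtension`).

THE PRINT ([Balaban1985Variational], CMP **102** (1985); journal page = PDF page + 276), pp. 297–298: *«we obtain the following equation on A′₁,
⟨δA′, J⟩ + ⟨δA′, ΔA′₁⟩ + ⟨δA′, (δ/δA′)V(A′₁)⟩ = 0 (127) for all δA′ satisfying QδA′ = 0. The configuration A′₁ satisfies RD*A′₁ = 0, hence the
above equation can be written as ⟨δA′, J⟩ + ⟨δA′, Δ_aA′₁⟩ + ⟨δA′, (δ/δA′)V(A′₁)⟩ = 0, (128) where Δ_a = Δ + DRD* + Q*aQ (the constant a = 1). …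
We decompose A′₁ = A₀ + H₀B, where H₀B is defined as a minimum of the quadratic form ½⟨A′, Δ_aA′⟩ on the subspace L^jηQA′ = B. We find easily
that H₀B is given by H₀ = GQ*(QGQ*)⁻¹ (129) … By the definition of H₀B and the condition QδA′ = 0 we have ⟨δA′, Δ_aH₀B⟩ = 0. Next, let us
construct a projection P₀ onto the subspace {A′ : QA′ = 0} in the space of fields A′ on Ω₀, with the scalar product ⟨·, Δ_a·⟩. It is again very
easy to find that the projection is given by P₀ = I − GQ*(QGQ*)⁻¹Q. (131) Taking δA′ = P₀A′, where A′ is arbitrary, and substituting into Eq. (128),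
we get … (132) By the definition of H₀B we have QA₀ = 0, hence P₀A₀ = A₀ … The above equation is satisfied for arbitrary A′, hence we get
A₀ = −GP₀*J + … − GP₀*((δ/δA′)V)(A₀ + H₀B) (133)»*; p. 300: *«GP₀* = G − GQ*(QGQ*)⁻¹QG = G̃, hence … A₀ = −G̃J + G̃Δ^{(2)}(A₀ + H₀B) −
G̃((δ/δA′)V)(A₀ + H₀B). (143)»*; p. 302: *«The image of U′_k is a minimum of 𝔊(A′), thus representing it as A₁ + HB, we obtain Eq. (143) for A₁.
In the considered case it can be written as A₁ + G̃((δ/δA′)V)(A₁ + HB) = 0. (158)»* (background 1: `J = 0`, `Δ^{(2)} = 0`).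

WHAT IS PROVED (sorry-free; no definition; axioms standard; Mathlib matrices over `ℝ`, finite index types `ι` (fine) and `κ` (coarse)):
* §1 `vecMul_injective_of_rightInverse` (`QH = 1 ⇒ Qᵀ` injective), **`posDef_QGQt`** (`Δ_a` positive definite and `QH = 1` ⇒ `K = QΔ_a⁻¹Qᵀ`
  positive definite, hence invertible), `transpose_inv_eq` (symmetry of `G`, `K⁻¹`).
* §2 for `H₀ = GQᵀK⁻¹`, `G̃ = G − GQᵀK⁻¹QG` (given as defining equations): **`Q_mul_H₀`** ((45)/(129) `QH₀ = 1`), **`Q_mul_Gt`** (*«Q𝔊 = 0»*,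
  `QG̃ = 0`), `dot_Δa_H₀_eq_zero` (*«⟨δA′, Δ_aH₀B⟩ = 0»* for `QδA′ = 0`), `Gt_transpose` (`G̃ᵀ = G̃`).
* §3 **`eq143_of_critical`** — THE DERIVATION: for every right inverse `H` of `Q` that is `Δ_a`-orthogonal to `ker Q` (e.g. `H₀`), if
  `⟨δ, Δ_aA′ + w⟩ = 0` for all `δ` with `Qδ = 0`, then `A₀ := A′ − H(QA′)` has `QA₀ = 0` and `A₀ = −G̃w` — (133)/(143)/(158) with `w = J + W(A′)`
  (background 1: `w = W(A₁ + HB)`); `critical_of_eq143` (the converse); `critical_Δa_of_critical_Δ` — the step (127) ⇒ (128): if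
  `Δ_a = Δ + N + a·QᵀQ` with `NA′ = 0` (print: `N = DRD*`, `RD*A′₁ = 0`) then criticality for `Δ` gives criticality for `Δ_a`.
HONEST SCOPE.  (i) Exact linear algebra; which `Δ`, `R`, `Q` (at the carrier: the Hessian of the Wilson action at background 1 in the chart of
`FlatChart47`, print's residual gauge operator, and the TRUE linearisation of the family's k-fold (0.4) descent — pillar C_k) and the positivity
of `Δ_a` (pillar F3 / `Prop7FlatCoercivityR`) are the user's; (ii) the analytic half of (158) (the bounds of `G̃` between the sizes, Prop. 6)
is parts 1–4 and pillar F3; (iii) the passage from criticality on the gauge-fixed constraint set (157) to criticality for all `δA′ ∈ ker Q`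
(p. 297, gauge invariance along the submanifolds (125)) is NOT typed here; (iv) NOT a claim about the mass gap.

References: T. Bałaban, CMP **102** (1985) 277–309 [Balaban1985Variational] (127)–(133) pp.297–298, (143) p.300, (158) p.302.
-/

set_option autoImplicit false

noncomputable section

open scoped BigOperators Matrix

namespace Summit.QuantumFields.YangMills.Theorems.FlatCriticalEquation143

variable {ι κ : Type*} [Fintype ι] [Fintype κ] [DecidableEq ι] [DecidableEq κ]

/-! ## §1 `K = QGQᵀ` is positive definite -/

omit [Fintype ι] [DecidableEq ι] in
/-- A right inverse makes the transpose injective: `QH = 1 ⇒ (x ↦ xQ = Qᵀx)` injective. [folklore] -/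
theorem vecMul_injective_of_rightInverse [Fintype ι] (Q : Matrix κ ι ℝ) (H : Matrix ι κ ℝ) (hQH : Q * H = 1) :
    Function.Injective Q.vecMul := by
  intro x y hxy
  have h : x ᵥ* Q ᵥ* H = y ᵥ* Q ᵥ* H := by
    show Matrix.vecMul (Matrix.vecMul x Q) H = Matrix.vecMul (Matrix.vecMul y Q) H
    rw [show Matrix.vecMul x Q = Matrix.vecMul y Q from hxy]
  rwa [Matrix.vecMul_vecMul, Matrix.vecMul_vecMul, hQH, Matrix.vecMul_one, Matrix.vecMul_one] at h

/-- **`K = QΔ_a⁻¹Qᵀ` IS POSITIVE DEFINITE** for `Δ_a` positive definite and `Q` with a right inverse ((129): the inverse `(QGQ*)⁻¹` exists).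
[cite: Balaban1985Variational, (129) p.297] -/
theorem posDef_QGQt (Δa : Matrix ι ι ℝ) (hΔ : Δa.PosDef) (Q : Matrix κ ι ℝ) (H : Matrix ι κ ℝ) (hQH : Q * H = 1) :
    (Q * Δa⁻¹ * Qᵀ).PosDef := by
  have h := hΔ.inv.mul_mul_conjTranspose_same (B := Q) (vecMul_injective_of_rightInverse Q H hQH)
  rwa [Matrix.conjTranspose_eq_transpose_of_trivial] at h

omit [Fintype κ] [DecidableEq κ] in
/-- The inverse of a symmetric matrix is symmetric. [folklore] -/
theorem transpose_inv_eq (M : Matrix ι ι ℝ) (hM : Mᵀ = M) : (M⁻¹)ᵀ = M⁻¹ := by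
  rw [Matrix.transpose_nonsing_inv, hM]

omit [Fintype κ] [DecidableEq κ] [Fintype ι] [DecidableEq ι] in
/-- A positive definite real matrix is symmetric. [folklore] -/
theorem transpose_eq_of_posDef (M : Matrix ι ι ℝ) (hM : M.PosDef) : Mᵀ = M := by
  have h := hM.isHermitian
  rwa [Matrix.IsHermitian, Matrix.conjTranspose_eq_transpose_of_trivial] at h

/-! ## §2 `H₀ = GQᵀK⁻¹`, `G̃ = G − GQᵀK⁻¹QG`: the identities (45)/(129), «Q𝔊 = 0», ⟨δ, Δ_aH₀B⟩ = 0, symmetry -/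

section Ops

variable (Δa : Matrix ι ι ℝ) (Q : Matrix κ ι ℝ) (H : Matrix ι κ ℝ) (G : Matrix ι ι ℝ) (K : Matrix κ κ ℝ)
  (H₀ : Matrix ι κ ℝ) (Gt : Matrix ι ι ℝ)

omit [DecidableEq ι] in
/-- **(45)/(129): `QH₀ = 1`** for `H₀ = GQᵀK⁻¹`, `K = QGQᵀ` invertible. [cite: Balaban1985Variational, (129) p.297] -/
theorem Q_mul_H₀ (hK : K = Q * G * Qᵀ) (hKu : IsUnit K.det) (hH₀ : H₀ = G * Qᵀ * K⁻¹) : Q * H₀ = 1 := by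
  rw [hH₀, ← Matrix.mul_assoc, ← Matrix.mul_assoc, ← hK, Matrix.mul_nonsing_inv _ hKu]

omit [DecidableEq ι] in
/-- **«Q𝔊 = 0» (p. 294) for `G̃ = G − GQᵀK⁻¹QG`**: `QG̃ = 0`. [cite: Balaban1985Variational, (143) p.300, (108)-(111) p.294] -/
theorem Q_mul_Gt (hK : K = Q * G * Qᵀ) (hKu : IsUnit K.det) (hGt : Gt = G - G * Qᵀ * K⁻¹ * Q * G) : Q * Gt = 0 := by
  rw [hGt, Matrix.mul_sub]
  have e : Q * (G * Qᵀ * K⁻¹ * Q * G) = (Q * G * Qᵀ) * K⁻¹ * (Q * G) := by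
    simp only [Matrix.mul_assoc]
  rw [e, ← hK, Matrix.mul_nonsing_inv _ hKu, Matrix.one_mul, sub_self]

/-- `Δ_aH₀ = QᵀK⁻¹` (for `G = Δ_a⁻¹`). [cite: Balaban1985Variational, (129) p.297] -/
theorem Δa_mul_H₀ (hΔu : IsUnit Δa.det) (hG : G = Δa⁻¹) (hH₀ : H₀ = G * Qᵀ * K⁻¹) : Δa * H₀ = Qᵀ * K⁻¹ := by
  rw [hH₀, hG, ← Matrix.mul_assoc, ← Matrix.mul_assoc, Matrix.mul_nonsing_inv _ hΔu, Matrix.one_mul]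

/-- **«By the definition of H₀B and the condition QδA′ = 0 we have ⟨δA′, Δ_aH₀B⟩ = 0»** (p. 298). [cite: Balaban1985Variational, (130) p.298] -/
theorem dot_Δa_H₀_eq_zero (hΔu : IsUnit Δa.det) (hG : G = Δa⁻¹) (hH₀ : H₀ = G * Qᵀ * K⁻¹)
    (δ : ι → ℝ) (hδ : Q *ᵥ δ = 0) (B : κ → ℝ) : δ ⬝ᵥ (Δa *ᵥ (H₀ *ᵥ B)) = 0 := by
  rw [Matrix.mulVec_mulVec, Δa_mul_H₀ Δa Q G K H₀ hΔu hG hH₀, ← Matrix.mulVec_mulVec, Matrix.dotProduct_mulVec,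
    Matrix.vecMul_transpose, hδ, zero_dotProduct]

/-- `G̃` is symmetric (for `Δ_a` symmetric). [cite: Balaban1985Variational, (143) p.300] -/
theorem Gt_transpose (hΔt : Δaᵀ = Δa) (hG : G = Δa⁻¹) (hK : K = Q * G * Qᵀ) (hGt : Gt = G - G * Qᵀ * K⁻¹ * Q * G) :
    Gtᵀ = Gt := by
  have hGt' : Gᵀ = G := by rw [hG]; exact transpose_inv_eq Δa hΔt
  have hKt : Kᵀ = K := by
    rw [hK, Matrix.transpose_mul, Matrix.transpose_mul, Matrix.transpose_transpose, hGt', Matrix.mul_assoc]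
  have hKit : (K⁻¹)ᵀ = K⁻¹ := transpose_inv_eq K hKt
  rw [hGt, Matrix.transpose_sub, hGt']
  congr 1
  simp only [Matrix.transpose_mul, Matrix.transpose_transpose, hGt', hKit, Matrix.mul_assoc]

/-- `Δ_aG̃ = 1 − QᵀK⁻¹QG` (= `P₀ᵀ`, the transpose of the projection (131)). [cite: Balaban1985Variational, (131) p.298] -/
theorem Δa_mul_Gt (hΔu : IsUnit Δa.det) (hG : G = Δa⁻¹) (hGt : Gt = G - G * Qᵀ * K⁻¹ * Q * G) :
    Δa * Gt = 1 - Qᵀ * K⁻¹ * Q * G := by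
  have h1 : Δa * G = 1 := by rw [hG, Matrix.mul_nonsing_inv _ hΔu]
  rw [hGt, Matrix.mul_sub, h1]
  congr 1
  calc Δa * (G * Qᵀ * K⁻¹ * Q * G) = (Δa * G) * Qᵀ * K⁻¹ * Q * G := by simp only [Matrix.mul_assoc]
    _ = Qᵀ * K⁻¹ * Q * G := by rw [h1, Matrix.one_mul]

/-! ## §3 The derivation (127) ⇒ (128) ⇒ (133)/(143)/(158) -/

/-- **[Balaban1985Variational] (128) ⟹ (133)/(143): THE CRITICAL-POINT EQUATION FROM CRITICALITY ON `{QA′ = B}`.**  Let `Δ_a` be positive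
definite, `G = Δ_a⁻¹`, `K = QGQᵀ`, `G̃ = G − GQᵀK⁻¹QG`, and let `H` be a right inverse of `Q` whose range is `Δ_a`-orthogonal to `ker Q`
(`⟨δ, Δ_aHB⟩ = 0` for `Qδ = 0`; e.g. `H = H₀ = GQᵀK⁻¹`, `dot_Δa_H₀_eq_zero`).  If `⟨δ, Δ_aA′ + w⟩ = 0` for every `δ` with `Qδ = 0` ((128) with
`w = J + ((δ/δA′)V)(A′)`), then `A₀ := A′ − H(QA′)` satisfies `QA₀ = 0` and `A₀ = −G̃w` — *«A₀ = −GP₀*J … − GP₀*((δ/δA′)V)(A₀ + H₀B) (133)»*,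
i.e. (143); at background 1 (`J = 0`): *«A₁ + G̃((δ/δA′)V)(A₁ + HB) = 0. (158)»*.  Proof as printed: `δ := P₀u` for arbitrary `u`
(`P₀ = 1 − GQᵀK⁻¹Q`, `QP₀ = 0`) gives `P₀ᵀ(Δ_aA₀ + w) = 0`, and `P₀ᵀΔ_aA₀ = Δ_aA₀` because `QA₀ = 0`. [cite: Balaban1985Variational, (128)-(133) pp.297-298, (143) p.300, (158) p.302] -/
theorem eq143_of_critical (hΔ : Δa.PosDef) (hG : G = Δa⁻¹) (hK : K = Q * G * Qᵀ) (hGt : Gt = G - G * Qᵀ * K⁻¹ * Q * G)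
    (hQH : Q * H = 1) (hHorth : ∀ (δ : ι → ℝ), Q *ᵥ δ = 0 → ∀ B : κ → ℝ, δ ⬝ᵥ (Δa *ᵥ (H *ᵥ B)) = 0)
    (A' w : ι → ℝ) (hcrit : ∀ δ : ι → ℝ, Q *ᵥ δ = 0 → δ ⬝ᵥ (Δa *ᵥ A' + w) = 0) :
    Q *ᵥ (A' - H *ᵥ (Q *ᵥ A')) = 0 ∧ A' - H *ᵥ (Q *ᵥ A') = -(Gt *ᵥ w) := by
  have hΔu : IsUnit Δa.det := (Matrix.isUnit_iff_isUnit_det _).1 hΔ.isUnit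
  have hKpd : K.PosDef := by rw [hK, hG]; exact posDef_QGQt Δa hΔ Q H hQH
  have hKu : IsUnit K.det := (Matrix.isUnit_iff_isUnit_det _).1 hKpd.isUnit
  have hΔt : Δaᵀ = Δa := transpose_eq_of_posDef Δa hΔ
  have hGt' : Gᵀ = G := by rw [hG]; exact transpose_inv_eq Δa hΔt
  have hKit : (K⁻¹)ᵀ = K⁻¹ := transpose_inv_eq K (transpose_eq_of_posDef K hKpd)
  have hGΔ : G * Δa = 1 := by rw [hG, Matrix.nonsing_inv_mul _ hΔu]
  set A₀ : ι → ℝ := A' - H *ᵥ (Q *ᵥ A') with hA₀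
  -- QA₀ = 0
  have hQA₀ : Q *ᵥ A₀ = 0 := by
    rw [hA₀, Matrix.mulVec_sub, Matrix.mulVec_mulVec, hQH, Matrix.one_mulVec, sub_self]
  refine ⟨hQA₀, ?_⟩
  -- ⟨δ, Δ_a A₀ + w⟩ = 0 for Qδ = 0
  have hcrit₀ : ∀ δ : ι → ℝ, Q *ᵥ δ = 0 → δ ⬝ᵥ (Δa *ᵥ A₀ + w) = 0 := by
    intro δ hδ
    have e : Δa *ᵥ A₀ + w = (Δa *ᵥ A' + w) - Δa *ᵥ (H *ᵥ (Q *ᵥ A')) := by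
      rw [hA₀, Matrix.mulVec_sub]; abel
    rw [e, dotProduct_sub, hcrit δ hδ, hHorth δ hδ, sub_zero]
  -- the projection P₀ = 1 − GQᵀK⁻¹Q, QP₀ = 0
  set P₀ : Matrix ι ι ℝ := 1 - G * Qᵀ * K⁻¹ * Q with hP₀
  have hQP₀ : Q * P₀ = 0 := by
    rw [hP₀, Matrix.mul_sub, Matrix.mul_one]
    have e : Q * (G * Qᵀ * K⁻¹ * Q) = (Q * G * Qᵀ) * K⁻¹ * Q := by simp only [Matrix.mul_assoc]
    rw [e, ← hK, Matrix.mul_nonsing_inv _ hKu, Matrix.one_mul, sub_self]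
  have hP₀t : P₀ᵀ = 1 - Qᵀ * K⁻¹ * Q * G := by
    rw [hP₀, Matrix.transpose_sub, Matrix.transpose_one]
    congr 1
    simp only [Matrix.transpose_mul, Matrix.transpose_transpose, hGt', hKit, Matrix.mul_assoc]
  -- P₀ᵀ (Δ_a A₀ + w) = 0, testing against δ := P₀ u for all u
  have hPv : P₀ᵀ *ᵥ (Δa *ᵥ A₀ + w) = 0 := by
    set v := Δa *ᵥ A₀ + w with hv
    have hall : ∀ u : ι → ℝ, u ⬝ᵥ (P₀ᵀ *ᵥ v) = 0 := by
      intro u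
      have hδ : Q *ᵥ (P₀ *ᵥ u) = 0 := by rw [Matrix.mulVec_mulVec, hQP₀, Matrix.zero_mulVec]
      have h := hcrit₀ (P₀ *ᵥ u) hδ
      rw [Matrix.dotProduct_mulVec, Matrix.vecMul_transpose]
      exact h
    exact dotProduct_self_eq_zero.1 (hall _)
  -- P₀ᵀ Δ_a A₀ = Δ_a A₀ since QA₀ = 0
  have hPΔ : P₀ᵀ *ᵥ (Δa *ᵥ A₀) = Δa *ᵥ A₀ := by
    rw [hP₀t, Matrix.sub_mulVec, Matrix.one_mulVec]
    have e : (Qᵀ * K⁻¹ * Q * G) *ᵥ (Δa *ᵥ A₀) = Qᵀ *ᵥ (K⁻¹ *ᵥ (Q *ᵥ ((G * Δa) *ᵥ A₀))) := by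
      simp only [Matrix.mulVec_mulVec, Matrix.mul_assoc]
    rw [e, hGΔ, Matrix.one_mulVec, hQA₀, Matrix.mulVec_zero, Matrix.mulVec_zero, sub_zero]
  -- hence Δ_a A₀ = −P₀ᵀ w and A₀ = −G P₀ᵀ w = −G̃ w
  have hΔA₀ : Δa *ᵥ A₀ = -(P₀ᵀ *ᵥ w) := by
    rw [Matrix.mulVec_add, hPΔ] at hPv
    exact eq_neg_of_add_eq_zero_left hPv
  have hGP : G * P₀ᵀ = Gt := by
    rw [hP₀t, hGt, Matrix.mul_sub, Matrix.mul_one]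
    simp only [Matrix.mul_assoc]
  calc A₀ = (G * Δa) *ᵥ A₀ := by rw [hGΔ, Matrix.one_mulVec]
    _ = G *ᵥ (Δa *ᵥ A₀) := by rw [Matrix.mulVec_mulVec]
    _ = -((G * P₀ᵀ) *ᵥ w) := by rw [hΔA₀, Matrix.mulVec_neg, Matrix.mulVec_mulVec]
    _ = -(Gt *ᵥ w) := by rw [hGP]

/-- **The converse**: if `QA₀ = 0` and `A₀ = −G̃w` then `⟨δ, Δ_a(A₀ + HB) + w⟩ = 0` for every `δ ∈ ker Q` and every `B` (with `H` `Δ_a`-orthogonal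
to `ker Q`) — solutions of (143) ARE critical on the constraint. [cite: Balaban1985Variational, (128) p.297, (143) p.300] -/
theorem critical_of_eq143 (hΔ : Δa.PosDef) (hG : G = Δa⁻¹) (hGt : Gt = G - G * Qᵀ * K⁻¹ * Q * G)
    (hHorth : ∀ (δ : ι → ℝ), Q *ᵥ δ = 0 → ∀ B : κ → ℝ, δ ⬝ᵥ (Δa *ᵥ (H *ᵥ B)) = 0)
    (A₀ w : ι → ℝ) (B : κ → ℝ) (hsol : A₀ = -(Gt *ᵥ w)) :
    ∀ δ : ι → ℝ, Q *ᵥ δ = 0 → δ ⬝ᵥ (Δa *ᵥ (A₀ + H *ᵥ B) + w) = 0 := by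
  intro δ hδ
  have hΔu : IsUnit Δa.det := (Matrix.isUnit_iff_isUnit_det _).1 hΔ.isUnit
  have hΔGt := Δa_mul_Gt Δa Q G K Gt hΔu hG hGt
  have e : Δa *ᵥ (A₀ + H *ᵥ B) + w = Δa *ᵥ (H *ᵥ B) + (Qᵀ * K⁻¹ * Q * G) *ᵥ w := by
    rw [Matrix.mulVec_add, hsol, Matrix.mulVec_neg, Matrix.mulVec_mulVec, hΔGt, Matrix.sub_mulVec, Matrix.one_mulVec]
    abel
  rw [e, dotProduct_add, hHorth δ hδ B, zero_add]
  have e2 : (Qᵀ * K⁻¹ * Q * G) *ᵥ w = Qᵀ *ᵥ ((K⁻¹ * Q * G) *ᵥ w) := by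
    simp only [Matrix.mulVec_mulVec, Matrix.mul_assoc]
  rw [e2, Matrix.dotProduct_mulVec, Matrix.vecMul_transpose, hδ, zero_dotProduct]

omit [DecidableEq ι] [DecidableEq κ] in
/-- **(127) ⟹ (128)**: *«The configuration A′₁ satisfies RD*A′₁ = 0, hence the above equation can be written as … (128) where Δ_a = Δ + DRD* +
Q*aQ»* — if `Δ_a = Δ + N + a·QᵀQ` with `NA′ = 0` (print: `N = DRD*`), criticality `⟨δ, ΔA′ + w⟩ = 0` on `ker Q` is criticality for `Δ_a`
(`⟨δ, NA′⟩ = 0`, `⟨δ, QᵀQA′⟩ = ⟨Qδ, QA′⟩ = 0`). [cite: Balaban1985Variational, (127)-(128) p.297] -/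
theorem critical_Δa_of_critical_Δ (Δ N : Matrix ι ι ℝ) (a : ℝ) (hsplit : Δa = Δ + N + a • (Qᵀ * Q)) (A' w : ι → ℝ)
    (hN : N *ᵥ A' = 0) (hcrit : ∀ δ : ι → ℝ, Q *ᵥ δ = 0 → δ ⬝ᵥ (Δ *ᵥ A' + w) = 0) :
    ∀ δ : ι → ℝ, Q *ᵥ δ = 0 → δ ⬝ᵥ (Δa *ᵥ A' + w) = 0 := by
  intro δ hδ
  have e : Δa *ᵥ A' = Δ *ᵥ A' + a • (Qᵀ *ᵥ (Q *ᵥ A')) := by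
    rw [hsplit, Matrix.add_mulVec, Matrix.add_mulVec, hN, add_zero, Matrix.smul_mulVec, Matrix.mulVec_mulVec]
  have hQ : δ ⬝ᵥ (Qᵀ *ᵥ (Q *ᵥ A')) = 0 := by
    rw [Matrix.dotProduct_mulVec, Matrix.vecMul_transpose, hδ, zero_dotProduct]
  rw [e, add_right_comm, dotProduct_add, hcrit δ hδ, dotProduct_smul, hQ, smul_zero, add_zero]

/-! ## §4 (appendix) `G̃ = (1 − H₀Q)G`, uniqueness of the `Δ_a`-orthogonal right inverse, and the minimum property (129) -/

omit [DecidableEq ι] in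
/-- **`G̃ = G − H₀QG = (1 − H₀Q)G`** — the constrained Green's function of (143)/(158) is `G` corrected by `H₀` and `Q` only, so its letters
(sup, weighted gradient, …) follow from those of `G`, `Q`, `H₀` (pillar F3's menu: `FlatPropagatorGradGlobal`, `FlatMinimizerH`) by the triangle
inequality. [cite: Balaban1985Variational, (131) p.298, (143) p.300] -/
theorem Gt_eq_G_sub_H₀QG (hH₀ : H₀ = G * Qᵀ * K⁻¹) (hGt : Gt = G - G * Qᵀ * K⁻¹ * Q * G) : Gt = G - H₀ * Q * G := by
  rw [hGt, hH₀]

/-- **UNIQUENESS: every right inverse of `Q` that is `Δ_a`-orthogonal to `ker Q` IS `H₀ = GQᵀK⁻¹`** (so print's `H` of (45) at background 1 — the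
minimiser with `QH = 1`, pillar F3's `FlatMinimizerH`/`FlatMinimizerHLandau` — coincides with `H₀` of (129) once its `Δ_a`-orthogonality is
checked). [cite: Balaban1985Variational, (129)-(130) pp.297-298, (45) p.285] -/
theorem rightInverse_eq_H₀ (hΔ : Δa.PosDef) (hG : G = Δa⁻¹) (hK : K = Q * G * Qᵀ) (hH₀ : H₀ = G * Qᵀ * K⁻¹) (hQH : Q * H = 1)
    (hHorth : ∀ (δ : ι → ℝ), Q *ᵥ δ = 0 → ∀ B : κ → ℝ, δ ⬝ᵥ (Δa *ᵥ (H *ᵥ B)) = 0) : H = H₀ := by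
  have hΔu : IsUnit Δa.det := (Matrix.isUnit_iff_isUnit_det _).1 hΔ.isUnit
  have hKpd : K.PosDef := by rw [hK, hG]; exact posDef_QGQt Δa hΔ Q H hQH
  have hKu : IsUnit K.det := (Matrix.isUnit_iff_isUnit_det _).1 hKpd.isUnit
  have hQH₀ : Q * H₀ = 1 := Q_mul_H₀ Q G K H₀ hK hKu hH₀
  rw [Matrix.ext_iff_mulVec]
  intro B
  set v : ι → ℝ := H *ᵥ B - H₀ *ᵥ B with hv
  have hQv : Q *ᵥ v = 0 := by
    rw [hv, Matrix.mulVec_sub, Matrix.mulVec_mulVec, Matrix.mulVec_mulVec, hQH, hQH₀, sub_self]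
  have h1 : v ⬝ᵥ (Δa *ᵥ (H *ᵥ B)) = 0 := hHorth v hQv B
  have h2 : v ⬝ᵥ (Δa *ᵥ (H₀ *ᵥ B)) = 0 := dot_Δa_H₀_eq_zero Δa Q G K H₀ hΔu hG hH₀ v hQv B
  have h3 : v ⬝ᵥ (Δa *ᵥ v) = 0 := by rw [hv, Matrix.mulVec_sub, dotProduct_sub, ← hv, h1, h2, sub_zero]
  by_contra hne
  have hv0 : v ≠ 0 := fun h => hne (sub_eq_zero.1 (by rw [← hv]; exact h))
  have hpos := hΔ.dotProduct_mulVec_pos hv0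
  rw [star_trivial, h3] at hpos
  exact lt_irrefl _ hpos

/-- **(129): `H₀B` MINIMISES `⟨A, Δ_aA⟩` ON `{QA = B}`** (*«H₀B is defined as a minimum of the quadratic form ½⟨A′, Δ_aA′⟩ on the subspace
L^jηQA′ = B»*): for every `A` with `QA = B`, `⟨H₀B, Δ_aH₀B⟩ ≤ ⟨A, Δ_aA⟩`. [cite: Balaban1985Variational, (129) p.297] -/
theorem H₀_minimises (hΔ : Δa.PosDef) (hG : G = Δa⁻¹) (hK : K = Q * G * Qᵀ) (hH₀ : H₀ = G * Qᵀ * K⁻¹) (hQH : Q * H = 1)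
    (B : κ → ℝ) (A : ι → ℝ) (hA : Q *ᵥ A = B) :
    (H₀ *ᵥ B) ⬝ᵥ (Δa *ᵥ (H₀ *ᵥ B)) ≤ A ⬝ᵥ (Δa *ᵥ A) := by
  have hΔu : IsUnit Δa.det := (Matrix.isUnit_iff_isUnit_det _).1 hΔ.isUnit
  have hKpd : K.PosDef := by rw [hK, hG]; exact posDef_QGQt Δa hΔ Q H hQH
  have hKu : IsUnit K.det := (Matrix.isUnit_iff_isUnit_det _).1 hKpd.isUnit
  have hQH₀ : Q * H₀ = 1 := Q_mul_H₀ Q G K H₀ hK hKu hH₀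
  have hΔt : Δaᵀ = Δa := transpose_eq_of_posDef Δa hΔ
  set v : ι → ℝ := A - H₀ *ᵥ B with hv
  have hQv : Q *ᵥ v = 0 := by rw [hv, Matrix.mulVec_sub, Matrix.mulVec_mulVec, hQH₀, Matrix.one_mulVec, hA, sub_self]
  have horth : v ⬝ᵥ (Δa *ᵥ (H₀ *ᵥ B)) = 0 := dot_Δa_H₀_eq_zero Δa Q G K H₀ hΔu hG hH₀ v hQv B
  have horth' : (H₀ *ᵥ B) ⬝ᵥ (Δa *ᵥ v) = 0 := by
    rw [Matrix.dotProduct_mulVec, ← Matrix.mulVec_transpose, hΔt, dotProduct_comm]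
    exact horth
  have hA' : A = H₀ *ᵥ B + v := by rw [hv]; abel
  have hexp : A ⬝ᵥ (Δa *ᵥ A) = (H₀ *ᵥ B) ⬝ᵥ (Δa *ᵥ (H₀ *ᵥ B)) + v ⬝ᵥ (Δa *ᵥ v) := by
    rw [hA', Matrix.mulVec_add, add_dotProduct, dotProduct_add, dotProduct_add, horth, horth']
    ring
  have hvv : 0 ≤ v ⬝ᵥ (Δa *ᵥ v) := by
    have := hΔ.posSemidef.dotProduct_mulVec_nonneg v
    rwa [star_trivial] at this
  rw [hexp]
  linarith

/-! ## §5 (appendix 2) From the minimum property to `Δ_a`-orthogonality; the (165) entry in matrix letters -/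

omit [DecidableEq ι] [DecidableEq κ] [Fintype κ] in
/-- **MINIMALITY ⟹ `Δ_a`-ORTHOGONALITY** (the first-order condition behind p. 298 *«By the definition of H₀B and the condition QδA′ = 0 we have
⟨δA′, Δ_aH₀B⟩ = 0»*): if `h` minimises `v ↦ ⟨v, Δ_av⟩` on the affine space `h + ker Q` (`Δ_a` symmetric), then `⟨δ, Δ_ah⟩ = 0` for every `δ ∈ ker Q` —
the hypothesis `hHorth` of `eq143_of_critical` for a right inverse given as a MINIMISER (pillar F3's `FlatMinimizerHLandau.curlAction_H_le` shape).
[cite: Balaban1985Variational, (129)-(130) pp.297-298] -/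
theorem dot_Δa_eq_zero_of_minimises (hΔt : Δaᵀ = Δa) (h : ι → ℝ)
    (hmin : ∀ v : ι → ℝ, Q *ᵥ v = 0 → h ⬝ᵥ (Δa *ᵥ h) ≤ (h + v) ⬝ᵥ (Δa *ᵥ (h + v)))
    (δ : ι → ℝ) (hδ : Q *ᵥ δ = 0) : δ ⬝ᵥ (Δa *ᵥ h) = 0 := by
  set a : ℝ := δ ⬝ᵥ (Δa *ᵥ δ) with ha
  set b : ℝ := δ ⬝ᵥ (Δa *ᵥ h) with hb
  have hsym : h ⬝ᵥ (Δa *ᵥ δ) = b := by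
    rw [hb, Matrix.dotProduct_mulVec, ← Matrix.mulVec_transpose, hΔt, dotProduct_comm]
  -- for every real t: 0 ≤ a t² + 2 b t
  have hquad : ∀ t : ℝ, 0 ≤ a * t ^ 2 + 2 * b * t := by
    intro t
    have hv : Q *ᵥ (t • δ) = 0 := by rw [Matrix.mulVec_smul, hδ, smul_zero]
    have hle := hmin (t • δ) hv
    have e : (h + t • δ) ⬝ᵥ (Δa *ᵥ (h + t • δ)) = h ⬝ᵥ (Δa *ᵥ h) + (a * t ^ 2 + 2 * b * t) := by
      rw [Matrix.mulVec_add, Matrix.mulVec_smul, add_dotProduct, dotProduct_add, dotProduct_add, dotProduct_smul, dotProduct_smul,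
        smul_dotProduct, smul_dotProduct, hsym, ← ha, ← hb]
      simp only [smul_eq_mul]
      ring
    linarith
  have ha0 : 0 ≤ a := by
    have := hquad 1
    have h2 := hquad (-1)
    nlinarith
  -- evaluate at t = −b/(a+1)
  have ha1 : 0 < a + 1 := by linarith
  have key := hquad (-b / (a + 1))
  have e : a * (-b / (a + 1)) ^ 2 + 2 * b * (-b / (a + 1)) = -(b ^ 2 * (a + 2)) / (a + 1) ^ 2 := by
    field_simp
    ring
  rw [e] at key
  have hnum : b ^ 2 * (a + 2) ≤ 0 := by
    have hden : 0 < (a + 1) ^ 2 := by positivity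
    have := mul_nonneg_iff_of_pos_right (inv_pos.2 hden) |>.1 (by rwa [neg_div, neg_nonneg, div_eq_mul_inv] at key)
    linarith
  have hb0 : b ^ 2 ≤ 0 := by nlinarith
  have : b = 0 := by nlinarith [sq_nonneg b]
  rw [hb] at this
  exact this

omit [DecidableEq ι] [DecidableEq κ] in
/-- **THE (165) ENTRY IN MATRIX LETTERS**: if `A₀ = −G̃w` (from `eq143_of_critical`), `|w(i)| ≤ ω` everywhere (Prop. 4: `ω = C₄‖A′‖²₍₁₁₅₎`), and a real
letter `N` satisfies `N(−G̃x) ≤ B_N·β` whenever `|x(i)| ≤ β`, then `N(A₀) ≤ B_N·ω` — *«+ B₀C₄(36dL²B₁Mε₀)²»*. [cite: Balaban1985Variational, (165) p.304] -/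
theorem letter_le_of_eq143 (A₀ w : ι → ℝ) (hsol : A₀ = -(Gt *ᵥ w)) {ω : ℝ} (hw : ∀ i, |w i| ≤ ω)
    (N : (ι → ℝ) → ℝ) {B : ℝ} (hN : ∀ (x : ι → ℝ) (β : ℝ), (∀ i, |x i| ≤ β) → N (-(Gt *ᵥ x)) ≤ B * β) : N A₀ ≤ B * ω := by
  rw [hsol]
  exact hN w ω hw

end Ops

end Summit.QuantumFields.YangMills.Theorems.FlatCriticalEquation143

end
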